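import Summits.HodgeConjecture.CorCM.AbelianTwoPowerThinKernel
import Literature.AlgebraicGeometry.Pohlmann1968.NondegenerateCMTypeHodgeConjecture
import Literature.AlgebraicGeometry.ComplexMultiplication.SimpleIffPrimitiveCMType
import Mathlib.FieldTheory.Galois.Basic
import HarnessLib

/-!
# Abelian CM fields of `2`-power degree CYCLIC OVER A REAL QUADRATIC FIELD (or over `ℚ`): the Hodge conjecture for
# every power of every simple CM abelian variety — unconditionally

COR-CM (cell `pub-hodgecm2`), binder seat b04 (gen 15), count-neutral claim ABELIAN-2POWER-CLASSIF, part Ib; the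
field-theoretic dress and the realisations of part Ia `CorCM/AbelianTwoPowerThinKernel`
(`ThinKernel.isNondegenerate_of_isPrimitive_of_mem_zpowers`: for `K` CM with abelian Galois group of order
`[K:ℚ] = 2^{n+1}` whose complex conjugation lies in a cyclic subgroup of index `≤ 2`, every primitive CM type is
nondegenerate).  KERNEL ONLY: theorems; no definition, no named fact, no `sorry`.  `HC_CM` is neither used nor
claimed.

* §3′ `isNondegenerate_of_isPrimitive_of_isCyclic_fixingSubgroup` / `…_of_isCyclic_over`: the hypothesis in field
  language — an intermediate field `L ⊆ K⁺` (fixed pointwise by complex conjugation) with `[L:ℚ] ≤ 2` and `Gal(K/L)`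
  cyclic (`IsCyclic L.fixingSubgroup`, resp. `IsCyclic (K ≃ₐ[L] K)` via `IntermediateField.fixingSubgroupEquiv`);
  the index of `Gal(K/L)` is `[L:ℚ]` by the tower law and `IsGalois.card_fixingSubgroup_eq_finrank`.
* §4 realisations `(A, ι, θ)` with `A` SIMPLE (⟺ `Φ` primitive, Shimura §8.2 Prop. 26, tree
  `isSimple_iff_isPrimitive`): `Bᵐ(Aᴺ) ⊗ ℂ = Dᵐ(Aᴺ) ⊗ ℂ` on all powers, no exceptional classes, and **the Hodge
  conjecture for `A` and all powers `Aᴺ`, UNCONDITIONALLY** (`hodgeConjectureFor_pow_of_isSimple_of_isCyclic_over`;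
  group form `hodgeConjectureFor_pow_of_isSimple_of_mem_zpowers`).

Instances (new beyond gen 11's cyclic fields and gen 13's octic fields): `K = K₁·ℚ(√d)`, `K₁` cyclic CM of degree
`2^a ≥ 8`, `d > 0` with `√d ∉ K₁` — Galois group `ℤ/2^a × ℤ/2` with complex conjugation `(2^{a−1}, 0)`; e.g.
`ℚ(ζ₃₂ − ζ₃₂⁻¹, √3)` (simple CM abelian eightfolds), `ℚ(ζ₆₄ − ζ₆₄⁻¹, √5)` (sixteenfolds).  Sharpness and the two
sporadic good pairs of order `16` are in parts II/III.

## References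

* [Kubota1965] T. Kubota, *On the field extension by complex multiplication*, Trans. AMS 118 (1965), §4 Lemma 2.
* [Shimura1998] G. Shimura, *Abelian Varieties with Complex Multiplication and Modular Functions*, §8.2 Prop. 26.
* [Gordon1999HodgeAVSurvey] B. B. Gordon, *A survey of the Hodge conjecture for abelian varieties*, 5.13, Thm. 6.4,
  §9.4.
-/

noncomputable section

open CategoryTheory CategoryTheory.Limits NumberField

namespace Summit.HodgeConjecture.CorCM.ThinKernel

open Literature.NumberTheory.ComplexMultiplication
open Literature.AlgebraicGeometry.Motives (AbelianVariety CMType)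
open Literature.AlgebraicGeometry.HodgeTheory
open Literature.AlgebraicGeometry.ComplexMultiplication (IsCMTypeRealisation isSimple_iff_isPrimitive)
open Literature.AlgebraicGeometry.VanGeemen1994 (hodgeClassSpan)
open Literature.Barriers.HodgeConjecture (divisorClassesSpan)
open Literature.AlgebraicGeometry.Pohlmann1968

/-! ## §3′ Cyclic over `ℚ` or over a real quadratic subfield -/

section Field

variable {K : Type} [Field K] [NumberField K] [IsCMField K] [IsGalois ℚ K] {Φ : CMType K}

/-- **`K` cyclic over a totally real subfield `L` of degree `≤ 2` ⟹ primitive types are nondegenerate.**  For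
`K` abelian CM of degree `2^{n+1}` and an intermediate field `L ⊆ K⁺` (fixed pointwise by complex conjugation) with
`[L:ℚ] ≤ 2` and `Gal(K/L)` CYCLIC — i.e. `K/ℚ` cyclic, or `K` cyclic over a REAL QUADRATIC subfield — every
primitive CM type of `K` is nondegenerate. [cite: Kubota1965, §4 Lemma 2] [cite: Shimura1998, §8.2 Prop. 26] -/
theorem isNondegenerate_of_isPrimitive_of_isCyclic_fixingSubgroup (hcomm : ∀ g h : K ≃ₐ[ℚ] K, g * h = h * g)
    {n : ℕ} (hK : Module.finrank ℚ K = 2 ^ (n + 1)) (L : IntermediateField ℚ K) (hL : Module.finrank ℚ L ≤ 2)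
    (hLreal : ∀ x ∈ L, IsCMField.complexConj K x = x) (hcyc : IsCyclic L.fixingSubgroup) (φ₀ : K →+* ℂ)
    (hprim : IsPrimitive (ℂ ≃+* ℂ) Φ.1 φ₀) : IsNondegenerate Φ := by
  obtain ⟨z₀, hz₀⟩ := hcyc.exists_generator
  -- `⟨z₀⟩ = Gal(K/L)` inside `Gal(K/ℚ)`
  have hZ : Subgroup.zpowers (z₀ : K ≃ₐ[ℚ] K) = L.fixingSubgroup := by
    refine le_antisymm ((Subgroup.zpowers_le).2 z₀.2) fun x hx => ?_
    obtain ⟨k, hk⟩ := Subgroup.mem_zpowers_iff.1 (hz₀ ⟨x, hx⟩)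
    exact Subgroup.mem_zpowers_iff.2 ⟨k, by rw [← Subgroup.coe_zpow, hk]⟩
  have hcz : (IsCMField.complexConj K).restrictScalars ℚ ∈ Subgroup.zpowers (z₀ : K ≃ₐ[ℚ] K) := by
    rw [hZ, IntermediateField.mem_fixingSubgroup_iff]
    intro x hx
    rw [AlgEquiv.restrictScalars_apply]
    exact hLreal x hx
  have hidx : (Subgroup.zpowers (z₀ : K ≃ₐ[ℚ] K)).index ≤ 2 := by
    rw [hZ]
    have h1 := L.fixingSubgroup.index_mul_card
    rw [IsGalois.card_fixingSubgroup_eq_finrank L, IsGalois.card_aut_eq_finrank,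
      ← Module.finrank_mul_finrank ℚ L K] at h1
    have hpos : 0 < Module.finrank L K := Module.finrank_pos
    have : L.fixingSubgroup.index = Module.finrank ℚ L := Nat.eq_of_mul_eq_mul_right hpos h1
    omega
  exact isNondegenerate_of_isPrimitive_of_mem_zpowers hcomm hK z₀ hcz hidx φ₀ hprim

/-- **The same with the Galois group `Gal(K/L)` of `K` over `L`** (Mathlib `K ≃ₐ[L] K`, isomorphic to the fixing
subgroup by `IntermediateField.fixingSubgroupEquiv`). [cite: Kubota1965, §4 Lemma 2] [cite: Shimura1998, §8.2 Prop. 26] -/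
theorem isNondegenerate_of_isPrimitive_of_isCyclic_over (hcomm : ∀ g h : K ≃ₐ[ℚ] K, g * h = h * g)
    {n : ℕ} (hK : Module.finrank ℚ K = 2 ^ (n + 1)) (L : IntermediateField ℚ K) (hL : Module.finrank ℚ L ≤ 2)
    (hLreal : ∀ x ∈ L, IsCMField.complexConj K x = x) (hcyc : IsCyclic (K ≃ₐ[L] K)) (φ₀ : K →+* ℂ)
    (hprim : IsPrimitive (ℂ ≃+* ℂ) Φ.1 φ₀) : IsNondegenerate Φ :=
  isNondegenerate_of_isPrimitive_of_isCyclic_fixingSubgroup hcomm hK L hL hLreal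
    (isCyclic_of_surjective _ (IntermediateField.fixingSubgroupEquiv L).symm.surjective) φ₀ hprim

/-- Rank form: Kubota rank `2^n + 1`. [cite: Kubota1965, §4 Lemma 2] -/
theorem cmTypeRank_eq_of_isPrimitive_of_isCyclic_over (hcomm : ∀ g h : K ≃ₐ[ℚ] K, g * h = h * g)
    {n : ℕ} (hK : Module.finrank ℚ K = 2 ^ (n + 1)) (L : IntermediateField ℚ K) (hL : Module.finrank ℚ L ≤ 2)
    (hLreal : ∀ x ∈ L, IsCMField.complexConj K x = x) (hcyc : IsCyclic (K ≃ₐ[L] K)) (φ₀ : K →+* ℂ)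
    (hprim : IsPrimitive (ℂ ≃+* ℂ) Φ.1 φ₀) : cmTypeRank Φ = 2 ^ n + 1 := by
  have h := (isNondegenerate_iff Φ).1
    (isNondegenerate_of_isPrimitive_of_isCyclic_over hcomm hK L hL hLreal hcyc φ₀ hprim)
  rw [hK, pow_succ, Nat.mul_div_cancel _ (by norm_num : 0 < 2)] at h
  exact h

end Field

/-! ## §4 Realisations: the Hodge conjecture for all powers of the simple CM abelian varieties of these fields -/

section Geometry

variable {K : Type} [Field K] [NumberField K] [IsCMField K] [IsGalois ℚ K] {Φ : CMType K}
variable {A : AbelianVariety ℂ} {ι : 𝓞 K →+* End A} {θ : K →+* Module.End ℂ (complexBetti A.X 1)}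

/-- **A SIMPLE abelian variety with CM by an abelian CM field of `2`-power degree, cyclic over a totally real
subfield of degree `≤ 2`, realises a nondegenerate type** (`A` simple ⟺ `Φ` primitive, Shimura §8.2 Prop. 26).
[cite: Shimura1998, §8.2 Prop. 26] [cite: Kubota1965, §4 Lemma 2] -/
theorem isNondegenerate_of_isSimple_of_isCyclic_over (hcomm : ∀ g h : K ≃ₐ[ℚ] K, g * h = h * g)
    {n : ℕ} (hK : Module.finrank ℚ K = 2 ^ (n + 1)) (L : IntermediateField ℚ K) (hL : Module.finrank ℚ L ≤ 2)
    (hLreal : ∀ x ∈ L, IsCMField.complexConj K x = x) (hcyc : IsCyclic (K ≃ₐ[L] K))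
    (hA : IsCMTypeRealisation Φ A ι θ) (hs : A.IsSimple) : IsNondegenerate Φ := by
  obtain ⟨φ₀⟩ := (inferInstance : Nonempty (K →+* ℂ))
  exact isNondegenerate_of_isPrimitive_of_isCyclic_over hcomm hK L hL hLreal hcyc φ₀
    ((isSimple_iff_isPrimitive hA φ₀).1 hs)

/-- The same under the group-theoretic hypothesis "complex conjugation lies in a cyclic subgroup of index `≤ 2`".
[cite: Shimura1998, §8.2 Prop. 26] [cite: Kubota1965, §4 Lemma 2] -/
theorem isNondegenerate_of_isSimple_of_mem_zpowers (hcomm : ∀ g h : K ≃ₐ[ℚ] K, g * h = h * g)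
    {n : ℕ} (hK : Module.finrank ℚ K = 2 ^ (n + 1)) (z : K ≃ₐ[ℚ] K)
    (hcz : (IsCMField.complexConj K).restrictScalars ℚ ∈ Subgroup.zpowers z)
    (hidx : (Subgroup.zpowers z).index ≤ 2) (hA : IsCMTypeRealisation Φ A ι θ) (hs : A.IsSimple) :
    IsNondegenerate Φ := by
  obtain ⟨φ₀⟩ := (inferInstance : Nonempty (K →+* ℂ))
  exact isNondegenerate_of_isPrimitive_of_mem_zpowers hcomm hK z hcz hidx φ₀
    ((isSimple_iff_isPrimitive hA φ₀).1 hs)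

/-- **`Bᵐ(Aⁿ) ⊗ ℂ = Dᵐ(Aⁿ) ⊗ ℂ` on every power** of such a simple CM abelian variety (`Hdg = Div` on all powers,
Gordon 5.13 (i) / Hazama 6.4). [cite: Gordon1999HodgeAVSurvey, 5.13 (i) and Thm. 6.4] -/
theorem hodgeClassSpan_pow_eq_divisorClassesSpan_of_isSimple_of_isCyclic_over
    (hcomm : ∀ g h : K ≃ₐ[ℚ] K, g * h = h * g) {n : ℕ} (hK : Module.finrank ℚ K = 2 ^ (n + 1))
    (L : IntermediateField ℚ K) (hL : Module.finrank ℚ L ≤ 2) (hLreal : ∀ x ∈ L, IsCMField.complexConj K x = x)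
    (hcyc : IsCyclic (K ≃ₐ[L] K)) (hA : IsCMTypeRealisation Φ A ι θ) (hs : A.IsSimple) (N m : ℕ) :
    hodgeClassSpan (⨁ fun _ : Fin N => A).dim (⨁ fun _ : Fin N => A).X m =
      divisorClassesSpan (⨁ fun _ : Fin N => A).X (⨁ fun _ : Fin N => A).dim m :=
  (isNondegenerate_of_isSimple_of_isCyclic_over hcomm hK L hL hLreal hcyc hA hs)
    |>.hodgeClassSpan_pow_eq_divisorClassesSpan hA N m

/-- **No power of such a simple CM abelian variety carries an exceptional Hodge class**: every rational
`(m,m)`-class on `Aᴺ` is a polynomial in divisor classes. [cite: Gordon1999HodgeAVSurvey, 5.13 (i) and Thm. 6.4] -/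
theorem mem_divisorClassesSpan_pow_of_isSimple_of_isCyclic_over (hcomm : ∀ g h : K ≃ₐ[ℚ] K, g * h = h * g)
    {n : ℕ} (hK : Module.finrank ℚ K = 2 ^ (n + 1)) (L : IntermediateField ℚ K) (hL : Module.finrank ℚ L ≤ 2)
    (hLreal : ∀ x ∈ L, IsCMField.complexConj K x = x) (hcyc : IsCyclic (K ≃ₐ[L] K))
    (hA : IsCMTypeRealisation Φ A ι θ) (hs : A.IsSimple) (N m : ℕ)
    {c : complexBetti (⨁ fun _ : Fin N => A).X (2 * m)} (hcQ : IsRationalClass c)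
    (hcH : IsOfHodgeType (⨁ fun _ : Fin N => A).dim (⨁ fun _ : Fin N => A).X (2 * m) m m c) :
    c ∈ divisorClassesSpan (⨁ fun _ : Fin N => A).X (⨁ fun _ : Fin N => A).dim m :=
  (isNondegenerate_of_isSimple_of_isCyclic_over hcomm hK L hL hLreal hcyc hA hs).mem_divisorClassesSpan_pow
    hA N m hcQ hcH

/-- **THE HODGE CONJECTURE FOR EVERY POWER `Aᴺ` OF EVERY SIMPLE ABELIAN VARIETY WITH COMPLEX MULTIPLICATION BY AN
ABELIAN CM FIELD OF `2`-POWER DEGREE WHICH IS CYCLIC OVER `ℚ` OR OVER A REAL QUADRATIC SUBFIELD — UNCONDITIONALLY**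
(no named fact; Lefschetz (1,1) and cup products via nondegeneracy).  New instances: `K = K₁·ℚ(√d)` with `K₁` a
cyclic CM field of degree `2^a ≥ 8` and `d > 0`, `√d ∉ K₁` — simple CM abelian varieties of dimension `2^a`
(`ℚ(ζ₃₂ − ζ₃₂⁻¹, √3)`: eightfolds). [cite: Gordon1999HodgeAVSurvey, 5.13 (i) and Thm. 6.4] [cite: Kubota1965, §4 Lemma 2] -/
theorem hodgeConjectureFor_pow_of_isSimple_of_isCyclic_over (hcomm : ∀ g h : K ≃ₐ[ℚ] K, g * h = h * g)
    {n : ℕ} (hK : Module.finrank ℚ K = 2 ^ (n + 1)) (L : IntermediateField ℚ K) (hL : Module.finrank ℚ L ≤ 2)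
    (hLreal : ∀ x ∈ L, IsCMField.complexConj K x = x) (hcyc : IsCyclic (K ≃ₐ[L] K))
    (hA : IsCMTypeRealisation Φ A ι θ) (hs : A.IsSimple) (N : ℕ) :
    HodgeConjectureFor (⨁ fun _ : Fin N => A).dim (⨁ fun _ : Fin N => A).X :=
  (isNondegenerate_of_isSimple_of_isCyclic_over hcomm hK L hL hLreal hcyc hA hs).hodgeConjectureFor_pow hA N

/-- **The Hodge conjecture for the simple abelian variety itself.** [cite: Gordon1999HodgeAVSurvey, 5.13 (i)] -/
theorem hodgeConjectureFor_of_isSimple_of_isCyclic_over (hcomm : ∀ g h : K ≃ₐ[ℚ] K, g * h = h * g)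
    {n : ℕ} (hK : Module.finrank ℚ K = 2 ^ (n + 1)) (L : IntermediateField ℚ K) (hL : Module.finrank ℚ L ≤ 2)
    (hLreal : ∀ x ∈ L, IsCMField.complexConj K x = x) (hcyc : IsCyclic (K ≃ₐ[L] K))
    (hA : IsCMTypeRealisation Φ A ι θ) (hs : A.IsSimple) : HodgeConjectureFor A.dim A.X :=
  (isNondegenerate_of_isSimple_of_isCyclic_over hcomm hK L hL hLreal hcyc hA hs).hodgeConjectureFor hA

/-- Group-theoretic form of the Hodge conjecture for all powers (complex conjugation in a cyclic subgroup of index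
`≤ 2`). [cite: Gordon1999HodgeAVSurvey, 5.13 (i) and Thm. 6.4] -/
theorem hodgeConjectureFor_pow_of_isSimple_of_mem_zpowers (hcomm : ∀ g h : K ≃ₐ[ℚ] K, g * h = h * g)
    {n : ℕ} (hK : Module.finrank ℚ K = 2 ^ (n + 1)) (z : K ≃ₐ[ℚ] K)
    (hcz : (IsCMField.complexConj K).restrictScalars ℚ ∈ Subgroup.zpowers z)
    (hidx : (Subgroup.zpowers z).index ≤ 2) (hA : IsCMTypeRealisation Φ A ι θ) (hs : A.IsSimple) (N : ℕ) :
    HodgeConjectureFor (⨁ fun _ : Fin N => A).dim (⨁ fun _ : Fin N => A).X :=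
  (isNondegenerate_of_isSimple_of_mem_zpowers hcomm hK z hcz hidx hA hs).hodgeConjectureFor_pow hA N

end Geometry

end Summit.HodgeConjecture.CorCM.ThinKernel

end
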